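import Mathlib.Order.Antisymmetrization
import Mathlib.Data.Multiset.Bind
import Literature.Computability.QuantumComplexity.CliffordPermutations
import HarnessLib

/-!
# The magic semiring: formal sums of multi-qubit states modulo stabilizer operations

Topic `Literature/Computability/QuantumComplexity`; definition request `defn-MagicClass` (route
QuantumAdvantage/MagicSpectrum, support item StrassenCompleteness). This is the stabilizer-rank
analogue of the semiring `T(K)` of 3-tensors modulo restriction (`TensorSemiring.lean`,
`Literature.Computability.AlgebraicComplexity.TensorClass`): Strassen's theory of asymptotic
spectra (Strassen 1988, §2; Zuiddam 2018, Ch. 2) applies to any commutative semiring with a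
*Strassen preorder*, and the semiring built here is the one whose rank function is the
stabilizer rank `χ` of Bravyi–Smith–Smolin / Bravyi–Gosset (proved in the sequel files).

## Objects

* `MagicTerm` — a pair `⟨n, ψ⟩` of a number of qubits and a vector `ψ : QReg n → ℂ`
  (not normalised, possibly zero); `MagicTerm.tensor ⟨a, ψ⟩ ⟨b, φ⟩ = ⟨a + b, ψ ⊗ φ⟩`
  (`Cryptography.tensorVec`), `MagicTerm.unit = ⟨0, 1⟩`.
* `PreMagic` — finite formal sums of terms (a wrapped `Multiset MagicTerm`), with `⊕` = sum of
  multisets, `⊗` = bilinear extension of `MagicTerm.tensor`, `0 = ∅`, `1 = {⟨0, 1⟩}`. These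
  operations satisfy the semiring axioms *on the nose* except commutativity of `⊗`
  (`instance : Semiring PreMagic`; associativity and unit laws of `⊗` hold literally because
  `(a + b) + c = a + (b + c)` and `0 + n = n` transport `tensorVec` to itself, `MagicTerm.ext_cast`).
* `PreMagic.Derives X Y` ("`X ≽ Y`", `Y` is obtained from `X` by stabilizer operations) — the
  smallest reflexive–transitive relation closed under `⊕`-contexts (`X ≽ Y → X ⊕ Z ≽ Y ⊕ Z`) and
  `⊗`-contexts (`X ≽ Y → X ⊗ Z ≽ Y ⊗ Z`) containing the generators
  - `[ψ] ≽ [C ψ]` for `C ∈ cliffordCircuits n` (Clifford unitaries are free),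
  - `[ψ] ≽ [c • ψ]` for every `c : ℂ` (including `0`),
  - `[ψ] ≽ [ψ ⊗ |0⟩]` (adjoining an ancilla; its converse is derivable, `Derives.ancillaInv` in
    the sequel, from the next generator),
  - `[ψ] ≽ [x ↦ ψ (Fin.snoc x false)]` (the `⟨0|`-projection = postselected computational-basis
    measurement of the last qubit),
  - MERGING `[ψ] ⊕ [φ] ≽ [ψ + φ]` (same number of qubits),
  - `[0ₙ] ≽ ∅` and `∅ ≽ [0ₙ]` (zero vectors are nothing).
  Left contexts, wire permutations (`Derives.perm`: permutations are Clifford SWAP networks,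
  `permGate_mem_cliffordCircuits`) and commutativity `X ⊗ Y ≽ Y ⊗ X` (`Derives.comm`) are derived.
* `PreMagic` is preordered by `X ≤ Y :⟺ Y ≽ X` ("`X` is derivable from `Y`", the argument order
  of `IsStrassenPreorder`/`TensorRestrictsTo`: small = cheap).

The quotient **`MagicClass := Antisymmetrization PreMagic (· ≤ ·)`** by mutual derivability, its
`CommSemiring` structure and the classes `MagicClass.mk ψ = [ψ]` of single states are in the
sequel `MagicClass.lean`; the Strassen-preorder axioms, the dictionary between spectral points and
functionals on states, and `rankOf le (mk ψ) = stabilizerRank ψ` follow in further sequels.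

## References

* V. Strassen, *The asymptotic spectrum of tensors*, J. reine angew. Math. 384 (1988), §2
  (asymptotic spectra of preordered commutative semirings). [Strassen1988]
* J. Zuiddam, *Algebraic complexity, asymptotic spectra and entanglement polytopes*, PhD thesis
  (2018), Ch. 2: §2.3 (Strassen preorder; the semiring of tensors as the quotient of formal objects
  by the equivalence generated by the preorder), §2.8 (rank). [Zuiddam2018]
* S. Bravyi, G. Smith, J. A. Smolin, Phys. Rev. X 6 (2016) 021043, §I (stabilizer rank; free
  operations: Clifford gates, computational-basis measurements, ancillas). [BravyiSmithSmolin2016]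
* S. Bravyi, D. Gosset, Phys. Rev. Lett. 116 (2016) 250501 (stabilizer rank `χ`). [BravyiGosset2016]
* S. Aaronson, D. Gottesman, Phys. Rev. A 70 (2004) 052328, §I, §III. [AaronsonGottesman2004]

## Design notes

* `PreMagic` is a one-field structure rather than `Multiset MagicTerm` itself, because
  `Multiset` already carries the sub-multiset partial order.
* The relation is an inductive `Prop`; the `⊕`- and `⊗`-contexts are the one-sided constructors
  `add_right`/`mul_right` (the other side follows from commutativity), exactly as requested.
* Reindexing along `n + 0 = n`, `(a + b) + c = a + (b + c)` needs no generator: the two terms are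
  *equal* (`MagicTerm.ext_cast`). Genuine wire permutations are Clifford circuits (three `CNOT`s
  per transposition), so no reindexing generator is needed either; this keeps the generator list
  literally the requested one and makes "Clifford-monotone" functionals automatically
  permutation-invariant.
* Nothing here uses that the vectors are states (no normalisation); scalars include `0`, so
  `[ψ] ≽ [0ₙ] ≽ ∅` (discarding is free), which gives `0 ≤ x` for all `x`.
-/

noncomputable section

namespace Literature.Computability.QuantumComplexity

open Cryptography Matrix

/-! ## Terms -/

/-- A **term** of the magic semiring: a number of qubits `n` and a vector `ψ ∈ ℂ^{2ⁿ}`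
(`QReg n → ℂ`), not necessarily normalised and possibly zero. [cite: BravyiSmithSmolin2016, §I] -/
structure MagicTerm where
  /-- the number of qubits -/
  n : ℕ
  /-- the vector -/
  vec : QReg n → ℂ

namespace MagicTerm

/-- The unit term `⟨0, 1⟩`: the amplitude `1` on the empty register. [cite: Zuiddam2018, §2.3] -/
def unit : MagicTerm := ⟨0, fun _ => 1⟩

/-- The tensor product of terms, `⟨a, ψ⟩ ⊗ ⟨b, φ⟩ = ⟨a + b, ψ ⊗ φ⟩` (`tensorVec`: the first `a`
wires carry `ψ`, the last `b` wires carry `φ`). [cite: BravyiSmithSmolin2016, §IV eq. (9)] -/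
def tensor (s t : MagicTerm) : MagicTerm := ⟨s.n + t.n, tensorVec s.vec t.vec⟩

/-- `(s ⊗ t).n = s.n + t.n`. [folklore] -/
@[simp] theorem tensor_n (s t : MagicTerm) : (s.tensor t).n = s.n + t.n := rfl

/-- `(s ⊗ t).vec = s.vec ⊗ t.vec`. [folklore] -/
@[simp] theorem tensor_vec (s t : MagicTerm) : (s.tensor t).vec = tensorVec s.vec t.vec := rfl

/-- **Transport along an equality of qubit numbers is equality of terms**: if `n = m` and `φ` is
`ψ` read through `Fin.cast`, then `⟨n, ψ⟩ = ⟨m, φ⟩`. This is why `n + 0 = n` and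
`(a + b) + c = a + (b + c)` need no reindexing generator. [folklore] -/
theorem ext_cast {n m : ℕ} (h : n = m) {ψ : QReg n → ℂ} {φ : QReg m → ℂ}
    (hφ : ∀ y : QReg m, φ y = ψ (fun i => y (Fin.cast h i))) : (⟨n, ψ⟩ : MagicTerm) = ⟨m, φ⟩ := by
  subst h
  have : φ = ψ := funext fun y => by simpa using hφ y
  rw [this]

/-- `⊗` of terms is associative on the nose (transport along `(a + b) + c = a + (b + c)`). [folklore] -/
theorem tensor_assoc (s t u : MagicTerm) : (s.tensor t).tensor u = s.tensor (t.tensor u) := by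
  obtain ⟨a, ψ⟩ := s
  obtain ⟨b, φ⟩ := t
  obtain ⟨c, χ⟩ := u
  refine ext_cast (Nat.add_assoc a b c) fun y => ?_
  simp only [tensor, tensorVec]
  rw [mul_assoc]
  congr 3
  funext k
  congr 1
  ext
  simp [Nat.add_assoc]

/-- `⟨0, 1⟩ ⊗ t = t` on the nose (transport along `0 + n = n`). [folklore] -/
theorem unit_tensor (t : MagicTerm) : unit.tensor t = t := by
  obtain ⟨n, ψ⟩ := t
  refine ext_cast (Nat.zero_add n) fun y => ?_
  simp only [unit, tensorVec, one_mul]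
  congr 1
  funext j
  congr 1
  ext
  simp

/-- `t ⊗ ⟨0, 1⟩ = t` on the nose. [folklore] -/
theorem tensor_unit (t : MagicTerm) : t.tensor unit = t := by
  obtain ⟨n, ψ⟩ := t
  refine ext_cast rfl fun y => ?_
  simp [unit, tensorVec]

end MagicTerm

/-! ## Formal sums of terms -/

/-- A **formal sum of multi-qubit states**: a finite multiset of terms `⟨n, ψ⟩` (the raw objects
of the magic semiring, before identification). [cite: Zuiddam2018, §2.3] -/
@[ext] structure PreMagic where
  /-- the terms of the formal sum, with multiplicity -/
  terms : Multiset MagicTerm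

namespace PreMagic

/-- The formal sum with the single term `s`. [folklore] -/
def single (s : MagicTerm) : PreMagic := ⟨{s}⟩

/-- `0 = ∅`, the empty formal sum. [cite: Zuiddam2018, §2.3] -/
instance : Zero PreMagic := ⟨⟨0⟩⟩

/-- `⊕` = union of formal sums. [cite: Zuiddam2018, §2.3] -/
instance : Add PreMagic := ⟨fun X Y => ⟨X.terms + Y.terms⟩⟩

/-- `1 = {⟨0, 1⟩}`. [cite: Zuiddam2018, §2.3] -/
instance : One PreMagic := ⟨single MagicTerm.unit⟩

/-- `⊗` = the bilinear extension of the tensor product of terms: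
`(Σᵢ sᵢ) ⊗ (Σⱼ tⱼ) = Σᵢ Σⱼ sᵢ ⊗ tⱼ`. [cite: Zuiddam2018, §2.3] -/
instance : Mul PreMagic := ⟨fun X Y => ⟨X.terms.bind fun s => Y.terms.map s.tensor⟩⟩

/-- Terms of `0`. [folklore] -/
@[simp] theorem terms_zero : (0 : PreMagic).terms = 0 := rfl

/-- Terms of a sum. [folklore] -/
@[simp] theorem terms_add (X Y : PreMagic) : (X + Y).terms = X.terms + Y.terms := rfl

/-- Terms of `1`. [folklore] -/
@[simp] theorem terms_one : (1 : PreMagic).terms = {MagicTerm.unit} := rfl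

/-- Terms of a product. [folklore] -/
@[simp] theorem terms_mul (X Y : PreMagic) :
    (X * Y).terms = X.terms.bind fun s => Y.terms.map s.tensor := rfl

/-- Terms of a singleton. [folklore] -/
@[simp] theorem terms_single (s : MagicTerm) : (single s).terms = {s} := rfl

/-- `{s} ⊗ {t} = {s ⊗ t}`. [folklore] -/
@[simp] theorem single_mul_single (s t : MagicTerm) : single s * single t = single (s.tensor t) := by
  ext1; simp

/-- **The formal sums form a semiring** under `⊕` and `⊗` (all axioms but commutativity of `⊗`
hold literally; commutativity holds after identification, `MagicClass`). [cite: Zuiddam2018, §2.3] -/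
instance : Semiring PreMagic where
  add_assoc X Y Z := by ext1; simp [add_assoc]
  zero_add X := by ext1; simp
  add_zero X := by ext1; simp
  add_comm X Y := by ext1; simp [add_comm]
  left_distrib X Y Z := by ext1; simp [Multiset.map_add, Multiset.bind_add]
  right_distrib X Y Z := by ext1; simp [Multiset.add_bind]
  zero_mul X := by ext1; simp
  mul_zero X := by ext1; simp
  mul_assoc X Y Z := by
    ext1
    simp only [terms_mul, Multiset.bind_assoc, Multiset.bind_map, Multiset.map_bind, Multiset.map_map]
    congr 1; funext s; congr 1; funext t; congr 1; funext u
    exact MagicTerm.tensor_assoc s t u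
  one_mul X := by
    ext1
    simp only [terms_mul, terms_one, Multiset.singleton_bind]
    conv_rhs => rw [← Multiset.map_id X.terms]
    congr 1; funext t; exact MagicTerm.unit_tensor t
  mul_one X := by
    ext1
    simp only [terms_mul, terms_one, Multiset.map_singleton, Multiset.bind_singleton]
    conv_rhs => rw [← Multiset.map_id X.terms]
    congr 1; funext t; exact MagicTerm.tensor_unit t
  nsmul := nsmulRec
  npow := npowRec

/-- Terms of a multiset sum of formal sums. [folklore] -/
theorem terms_multisetSum (M : Multiset PreMagic) : M.sum.terms = (M.map terms).sum := by
  induction M using Multiset.induction_on with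
  | empty => rfl
  | cons X M ih => rw [Multiset.sum_cons, Multiset.map_cons, Multiset.sum_cons, terms_add, ih]

/-- A formal sum is the sum of its singletons. [folklore] -/
theorem eq_sum_single (X : PreMagic) : X = (X.terms.map single).sum := by
  ext1
  rw [terms_multisetSum, Multiset.map_map]
  exact (Multiset.sum_map_singleton X.terms).symm

/-- A termwise image of a formal sum is a sum of singletons. [folklore] -/
theorem map_eq_sum_single (X : PreMagic) (k : MagicTerm → MagicTerm) :
    (⟨X.terms.map k⟩ : PreMagic) = (X.terms.map fun s => single (k s)).sum := by
  ext1
  rw [terms_multisetSum, Multiset.map_map]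
  change X.terms.map k = (X.terms.map fun s => ({k s} : Multiset MagicTerm)).sum
  have e : (X.terms.map fun s => ({k s} : Multiset MagicTerm)) =
      (X.terms.map k).map fun t => ({t} : Multiset MagicTerm) := by
    rw [Multiset.map_map]; rfl
  rw [e, Multiset.sum_map_singleton]

/-- A bind of formal sums is a sum. [folklore] -/
theorem bind_eq_sum (X : PreMagic) (K : MagicTerm → PreMagic) :
    (⟨X.terms.bind fun s => (K s).terms⟩ : PreMagic) = (X.terms.map K).sum := by
  ext1
  rw [terms_multisetSum, Multiset.map_map]
  rfl

/-! ## Derivability -/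

/-- **Derivability `X ≽ Y`** ("`Y` is obtained from `X` by stabilizer operations"): the smallest
reflexive, transitive relation on formal sums that is closed under `⊕`- and `⊗`-contexts and
contains the generators: Clifford circuits, complex rescaling (including by `0`), adjoining an
ancilla `|0⟩`, the `⟨0|`-projection of the last qubit, MERGING two terms on the same register into
their sum, and discarding/creating zero vectors. These are the free operations of stabilizer-rank
simulation (Bravyi–Smith–Smolin 2016, §I; Bravyi–Gosset 2016) together with the bookkeeping of a
decomposition as a formal sum. [cite: BravyiSmithSmolin2016, §I] -/
inductive Derives : PreMagic → PreMagic → Prop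
  /-- reflexivity -/
  | refl (X : PreMagic) : Derives X X
  /-- transitivity -/
  | trans {X Y Z : PreMagic} : Derives X Y → Derives Y Z → Derives X Z
  /-- `⊕`-contexts -/
  | add_right {X Y : PreMagic} (Z : PreMagic) : Derives X Y → Derives (X + Z) (Y + Z)
  /-- `⊗`-contexts -/
  | mul_right {X Y : PreMagic} (Z : PreMagic) : Derives X Y → Derives (X * Z) (Y * Z)
  /-- Clifford circuits: `[ψ] ≽ [C ψ]` -/
  | clifford {n : ℕ} {C : Matrix (QReg n) (QReg n) ℂ} (hC : C ∈ cliffordCircuits n)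
      (ψ : QReg n → ℂ) : Derives (single ⟨n, ψ⟩) (single ⟨n, C *ᵥ ψ⟩)
  /-- rescaling: `[ψ] ≽ [c • ψ]` -/
  | smul {n : ℕ} (c : ℂ) (ψ : QReg n → ℂ) : Derives (single ⟨n, ψ⟩) (single ⟨n, c • ψ⟩)
  /-- ancilla: `[ψ] ≽ [ψ ⊗ |0⟩]` -/
  | ancilla {n : ℕ} (ψ : QReg n → ℂ) :
      Derives (single ⟨n, ψ⟩) (single ⟨n + 1, tensorVec ψ (zeroState 1)⟩)
  /-- projection of the last qubit onto `⟨0|`: `[ψ] ≽ [x ↦ ψ (x, 0)]` -/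
  | proj {n : ℕ} (ψ : QReg (n + 1) → ℂ) :
      Derives (single ⟨n + 1, ψ⟩) (single ⟨n, fun x => ψ (Fin.snoc x false)⟩)
  /-- merging: `[ψ] ⊕ [φ] ≽ [ψ + φ]` -/
  | merge {n : ℕ} (ψ φ : QReg n → ℂ) :
      Derives (single ⟨n, ψ⟩ + single ⟨n, φ⟩) (single ⟨n, ψ + φ⟩)
  /-- discarding a zero vector: `[0ₙ] ≽ ∅` -/
  | discard (n : ℕ) : Derives (single ⟨n, 0⟩) 0
  /-- creating a zero vector: `∅ ≽ [0ₙ]` -/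
  | create (n : ℕ) : Derives 0 (single ⟨n, 0⟩)

/-- **The derivability preorder**: `X ≤ Y :⟺ Y ≽ X` (`X` is obtained from `Y`; "smaller = cheaper",
the orientation of `IsStrassenPreorder` and of `TensorClass`). [cite: Zuiddam2018, §2.3] -/
instance : Preorder PreMagic where
  le X Y := Derives Y X
  le_refl X := Derives.refl X
  le_trans _ _ _ h h' := h'.trans h

/-- Unfolding of `≤`. [folklore] -/
theorem le_def (X Y : PreMagic) : X ≤ Y ↔ Derives Y X := Iff.rfl

namespace Derives

variable {X Y X' Y' Z : PreMagic}

/-- Left `⊕`-contexts (from `add_right` and commutativity of `⊕`). [folklore] -/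
theorem add_left (Z : PreMagic) (h : Derives X Y) : Derives (Z + X) (Z + Y) := by
  rw [add_comm Z X, add_comm Z Y]; exact h.add_right Z

/-- `⊕` is monotone in both arguments. [cite: Zuiddam2018, §2.3] -/
theorem add (h : Derives X Y) (h' : Derives X' Y') : Derives (X + X') (Y + Y') :=
  (h.add_right X').trans (h'.add_left Y)

/-- Termwise derivations assemble over a multiset (`⊕`-contexts). [folklore] -/
theorem multiset_map {α : Type*} (M : Multiset α) {f g : α → PreMagic}
    (h : ∀ a ∈ M, Derives (f a) (g a)) : Derives (M.map f).sum (M.map g).sum := by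
  induction M using Multiset.induction_on with
  | empty => exact refl _
  | cons a M ih =>
    rw [Multiset.map_cons, Multiset.map_cons, Multiset.sum_cons, Multiset.sum_cons]
    exact (h a (Multiset.mem_cons_self a M)).add
      (ih fun b hb => h b (Multiset.mem_cons_of_mem hb))

/-- A formal sum whose terms are mapped termwise along derivations. [folklore] -/
theorem of_terms_map {f g : MagicTerm → MagicTerm} (X : PreMagic)
    (h : ∀ s ∈ X.terms, Derives (single (f s)) (single (g s))) :
    Derives ⟨X.terms.map f⟩ ⟨X.terms.map g⟩ := by
  rw [map_eq_sum_single X f, map_eq_sum_single X g]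
  exact multiset_map X.terms h

/-- A bind whose summands are replaced along derivations. [folklore] -/
theorem of_terms_bind {F G : MagicTerm → PreMagic} (X : PreMagic)
    (h : ∀ s ∈ X.terms, Derives (F s) (G s)) :
    Derives ⟨X.terms.bind fun s => (F s).terms⟩ ⟨X.terms.bind fun s => (G s).terms⟩ := by
  rw [bind_eq_sum X F, bind_eq_sum X G]
  exact multiset_map X.terms h

/-- **Wire permutations are free**: `[ψ] ≽ [x ↦ ψ (x ∘ π)]` (a permutation is a Clifford SWAP
network, `permGate_mem_cliffordCircuits`). [cite: NielsenChuang2010, §1.3.4] -/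
theorem perm {n : ℕ} (π : Equiv.Perm (Fin n)) (ψ : QReg n → ℂ) :
    Derives (single ⟨n, ψ⟩) (single ⟨n, fun x => ψ (x ∘ π)⟩) := by
  rw [← permGate_mulVec_eq]
  exact clifford (permGate_mem_cliffordCircuits π) ψ

/-- **The tensor flip** `[ψ ⊗ φ] ≽ [φ ⊗ ψ]`: the block swap of the wires is a permutation, and
`b + a = a + b` is a transport. [cite: NielsenChuang2010, §1.3.4] -/
theorem tensor_swap (s t : MagicTerm) : Derives (single (s.tensor t)) (single (t.tensor s)) := by
  obtain ⟨a, ψ⟩ := s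
  obtain ⟨b, φ⟩ := t
  have h : a + b = b + a := Nat.add_comm a b
  let π : Equiv.Perm (Fin (a + b)) := finAddFlip.trans (finCongr h.symm)
  have key : (⟨a + b, fun x => tensorVec ψ φ (x ∘ π)⟩ : MagicTerm) = ⟨b + a, tensorVec φ ψ⟩ := by
    refine MagicTerm.ext_cast h fun y => ?_
    simp only [tensorVec, Function.comp_def, π, Equiv.trans_apply, finAddFlip_apply_castAdd,
      finAddFlip_apply_natAdd, finCongr_apply, Fin.cast_cast, Fin.cast_eq_self, mul_comm]
  have := perm π (tensorVec ψ φ)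
  rwa [key] at this

/-- **`⊗` is commutative up to derivability**: `X ⊗ Y ≽ Y ⊗ X`. [cite: Zuiddam2018, §2.3] -/
theorem comm (X Y : PreMagic) : Derives (X * Y) (Y * X) := by
  have e : Y * X = ⟨X.terms.bind fun s => Y.terms.map fun t => t.tensor s⟩ := by
    ext1; rw [terms_mul, Multiset.bind_map_comm]
  rw [e]
  exact of_terms_bind (F := fun s => ⟨Y.terms.map s.tensor⟩)
    (G := fun s => ⟨Y.terms.map fun t => t.tensor s⟩) X
    fun s _ => of_terms_map Y fun t _ => tensor_swap s t

/-- Left `⊗`-contexts. [cite: Zuiddam2018, §2.3] -/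
theorem mul_left (Z : PreMagic) (h : Derives X Y) : Derives (Z * X) (Z * Y) :=
  ((comm Z X).trans (h.mul_right Z)).trans (comm Y Z)

/-- `⊗` is monotone in both arguments. [cite: Zuiddam2018, §2.3] -/
theorem mul (h : Derives X Y) (h' : Derives X' Y') : Derives (X * X') (Y * Y') :=
  (h.mul_right X').trans (h'.mul_left Y)

end Derives

end PreMagic

end Literature.Computability.QuantumComplexity

end
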